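import Literature.LinearAlgebra.Matrix.SylvesterFranke                          -- ★ `compound`, `compound_apply`
import Summits.HodgeConjecture.HodgeConjecture.Theorems.K2LiuPluckerMinors     -- ★ F1 (p854930): minors of `[Y | 1]`
import Mathlib.Order.Hom.PowersetCard
import Mathlib.Analysis.Normed.Ring.Basic
import HarnessLib

/-!
# Crux `HLiu418`, Track B road `K2_Liu`, unit U5 «DOUBLING ZETA», socket #16a (organ (IV-c)) — helper «F4»:
# coordinates of a compound (Plücker) row — every INJECTIVE column selection is a coordinate up to sign; the doubling
# element `(G | −1)` has Plücker coordinates `±1` and `±Gᵢⱼ`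

Cell `hodgecm-mathlib`, crux item hLiu418 = `stmt-HodgeConjecture-24832`, route of record `HCCMUnconditional`; squad K2 ∕ K2Liu, prover
K2Liu-p04 (g0) (socket #16a `sig_K2LiuDoublingHeightDecayPointwise`, U5 ED. 5 652390c11702f8de :235; REPORT-FIRST K2/STATUS 21:5xZ, file (F4)).
THEOREMS ONLY (pure algebra over a commutative ring; no `def`, no instance, no notation, no `sorry`); lane `--supports stmt-HodgeConjecture-24832
--as helper` (count-neutral).

WHY.  The height of record (★ p854922 `K2LiuSiegelDoubledPluckerHeight.exists_siegelHeight`, K2Liu-p09) reads the Plücker vector of `h ∈ H(𝔸)` as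
the row `I₁` of the COMPOUND `compound n (R₀ · h)` (★ `Literature.LinearAlgebra.Matrix.compound`, indexed by `Set.powersetCard (Fin (n+n)) n`, each
`n`-subset of columns read in increasing order), while the decay estimate (IV-c) wants to SEE particular minors — «the columns of the `−1` block» and
«those columns with one replaced by a column of `G`» for the doubling element `R₀ · ι(g, 1) = (G | −1)` (★ F1 `det_submatrix_fromCols_one_inr ∕
_colSel`).  Computing `Finset.orderEmbOfFin` of such sets is avoidable:

* §1 `exists_perm_comp_eq_of_range_eq` — two injections `Fin k → κ` with the same range differ by a permutation of `Fin k`;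
  **`exists_compound_eq_sign_mul_det_submatrix`** — for `A : m × κ` with `card m = k`, EVERY injective column selection `f : m ↪ κ` is a
  coordinate of the compound row up to sign: `∃ J σ, (A.submatrix id f).det = sign σ · compound k A I J` (any row index `I`; for `card m = k` there is
  only one).  Hence `exists_compound_norm_eq` — over a normed commutative ring, `∃ J, ‖compound k A I J‖ = ‖(A.submatrix id f).det‖`.
* §2 **the doubling coordinates**: for `A = [Y | 1] ∘ ε⁻¹` (and `[Y | −1] ∘ ε⁻¹`, `Matrix.fromCols` read through an enumeration
  `ε : m ⊕ m ≃ κ` of the columns, `κ` linearly ordered — `ε = e₂` in the U5 frame), `∃ J, ‖compound A I J‖ = 1` and `∀ i j, ∃ J,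
  ‖compound A I J‖ = ‖Y i j‖` (`exists_compound_fromCols_one_norm_eq_one ∕ _norm_eq_entry`, and the `−1` variants via `det_neg`) — the two facts that
  make the local Plücker height of `ι(g,1)` dominate `max(1, |gᵢⱼ|)` at every place (file (F6) of the plan; the reindexing `e₂`, `e : Fin N × Fin 1 ≃ Fin n`
  of the U5 frame is a further `submatrix` by an `Equiv`, covered by §1 with `f := selection ∘ e₂`).

HONEST LABEL.  Count-neutral algebra helper; #16a itself also needs (F2) height monotonicity, (F3) `adelicHeightGL` vs vector heights, (F5) unitary
inverses (★ F1 §3 + Galois invariance) and (F6) assembly.  `HC_CM` is proved only modulo the 7 printed citations (2 remaining named inputs: hLiu418 =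
`stmt-HodgeConjecture-24832`, h413 = `stmt-HodgeConjecture-24833`) until rung 0 closes.
-/

set_option autoImplicit false
-- the mandated namespace repeats the single-problem summit's segment (`HodgeConjecture.HodgeConjecture`)
set_option linter.dupNamespace false

namespace Summit.HodgeConjecture.HodgeConjecture.Cruxes.HLiu418.K2LiuDoublingPluckerCoordinates

open Literature.LinearAlgebra.Matrix Set.powersetCard
open Summit.HodgeConjecture.HodgeConjecture.Cruxes.HLiu418.K2LiuPluckerMinors

/-! ## §1 Injective column selections are compound coordinates up to sign -/

/-- An injection `Fin k → κ` and a map `Fin k → κ` with the same range differ by a permutation of `Fin k`. [folklore] -/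
theorem exists_perm_comp_eq_of_range_eq {κ : Type*} {k : ℕ} {g e : Fin k → κ} (hg : Function.Injective g)
    (h : Set.range g = Set.range e) :
    ∃ σ : Equiv.Perm (Fin k), g = e ∘ σ := by
  classical
  have hmem : ∀ i, ∃ j, e j = g i := fun i => by
    have : g i ∈ Set.range e := h ▸ Set.mem_range_self i
    exact this
  choose τ hτ using hmem
  have hτinj : Function.Injective τ := fun i j hij => hg (by rw [← hτ i, ← hτ j, hij])
  refine ⟨Equiv.ofBijective τ (Finite.injective_iff_bijective.1 hτinj), funext fun i => ?_⟩
  simp [hτ i]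

/-- **Every injective column selection is a compound coordinate up to sign.**  For `A : m × κ` over a commutative ring with `card m = k`,
an injective `f : m → κ` and any row index `I : Set.powersetCard m k`: `(A.submatrix id f).det = sign σ · compound k A I J` for the column set
`J = range f` and a permutation `σ` (the increasing re-enumeration of `range f`). [cite: Bernstein2009, Fact 7.5.17 (p. 452)] -/
theorem exists_compound_eq_sign_mul_det_submatrix {R : Type*} [CommRing R] {m κ : Type*} [LinearOrder m] [LinearOrder κ]
    [Fintype m] {k : ℕ} (hm : Fintype.card m = k) (A : Matrix m κ R) {f : m → κ} (hf : Function.Injective f)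
    (I : Set.powersetCard m k) :
    ∃ (J : Set.powersetCard κ k) (σ : Equiv.Perm (Fin k)),
      (A.submatrix id f).det = (Equiv.Perm.sign σ : R) * compound k A I J := by
  classical
  -- the row enumeration of `I` is a bijection `Fin k ≃ m`
  set eI : Fin k ↪o m := ofFinEmbEquiv.symm I with heI
  have hbij : Function.Bijective eI :=
    (Fintype.bijective_iff_injective_and_card eI).2 ⟨eI.injective, by rw [Fintype.card_fin, hm]⟩
  set E : Fin k ≃ m := Equiv.ofBijective eI hbij with hE
  -- the column set `J = range (f ∘ eI)` and its increasing enumeration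
  set gcol : Fin k ↪ κ := eI.toEmbedding.trans ⟨f, hf⟩ with hgcol
  set J : Set.powersetCard κ k := ofFinEmb k κ gcol with hJ
  set eJ : Fin k ↪o κ := ofFinEmbEquiv.symm J with heJ
  have hrange : Set.range (gcol : Fin k → κ) = Set.range eJ := by
    ext x
    rw [← mem_ofFinEmb_iff_mem_range, mem_range_ofFinEmbEquiv_symm_iff_mem]
  obtain ⟨σ, hσ⟩ := exists_perm_comp_eq_of_range_eq gcol.injective hrange
  refine ⟨J, σ, ?_⟩
  have h1 : (A.submatrix id f).det = ((A.submatrix id f).submatrix E E).det := (Matrix.det_submatrix_equiv_self E _).symm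
  have h2 : (A.submatrix id f).submatrix E E = (A.submatrix (eI : Fin k → m) (eJ : Fin k → κ)).submatrix id σ := by
    ext i j
    simp only [Matrix.submatrix_apply, id, hE, Equiv.ofBijective_apply]
    have : f (eI j) = eJ (σ j) := by
      have := congr_fun hσ j
      simpa [hgcol] using this
    rw [this]
  rw [h1, h2, Matrix.det_permute', compound_apply]

/-- **Norms**: over a normed commutative ring (e.g. a completion `L_w`), every injective column selection gives a compound coordinate of
the same norm (`sign σ = ±1`). [cite: Bernstein2009, Fact 7.5.17 (p. 452)] -/
theorem exists_compound_norm_eq {R : Type*} [NormedCommRing R] {m κ : Type*} [LinearOrder m] [LinearOrder κ] [Fintype m] {k : ℕ}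
    (hm : Fintype.card m = k) (A : Matrix m κ R) {f : m → κ} (hf : Function.Injective f) (I : Set.powersetCard m k) :
    ∃ J : Set.powersetCard κ k, ‖compound k A I J‖ = ‖(A.submatrix id f).det‖ := by
  obtain ⟨J, σ, h⟩ := exists_compound_eq_sign_mul_det_submatrix hm A hf I
  refine ⟨J, ?_⟩
  rw [h]
  rcases Int.units_eq_one_or (Equiv.Perm.sign σ) with hs | hs
  · rw [hs, Units.val_one, Int.cast_one, one_mul]
  · rw [hs, Units.val_neg, Units.val_one, Int.cast_neg, Int.cast_one, neg_one_mul, norm_neg]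

/-! ## §2 The Plücker coordinates of `[Y | 1]` and `[Y | −1]`: the constant `1` and every entry of `Y`

The column type `m ⊕ m` carries no order; as in the height of record we read the columns through an enumeration `ε : m ⊕ m ≃ κ` into a
linearly ordered `κ` (there `κ = Fin (n + n)`, `ε = e₂ = finSumFinEquiv`), i.e. for `A = [Y | ±1] ∘ ε⁻¹ = (fromCols Y (±1)).submatrix id ε.symm`. -/

/-- Reading `[Y | B]` through `ε` and then selecting the columns `ε ∘ f` is selecting the columns `f` of `[Y | B]`. [folklore] -/
theorem submatrix_symm_submatrix {R : Type*} {m κ ι : Type*} (X : Matrix m (m ⊕ m) R) (ε : m ⊕ m ≃ κ) (f : ι → m ⊕ m) :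
    (X.submatrix id ε.symm).submatrix id (ε ∘ f) = X.submatrix id f := by
  ext i j
  simp

/-- For `A = [Y | 1] ∘ ε⁻¹`: some compound coordinate has norm `1` (the identity columns). [cite: GelbartPiatetskishapiroRallis1987, Part A §1] -/
theorem exists_compound_fromCols_one_norm_eq_one {R : Type*} [NormedCommRing R] [NormOneClass R] {m κ : Type*} [LinearOrder m]
    [LinearOrder κ] [Fintype m] {k : ℕ} (hm : Fintype.card m = k) (ε : m ⊕ m ≃ κ) (Y : Matrix m m R) (I : Set.powersetCard m k) :
    ∃ J : Set.powersetCard κ k, ‖compound k ((Matrix.fromCols Y (1 : Matrix m m R)).submatrix id ε.symm) I J‖ = 1 := by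
  obtain ⟨J, hJ⟩ := exists_compound_norm_eq hm ((Matrix.fromCols Y (1 : Matrix m m R)).submatrix id ε.symm)
    (ε.injective.comp Sum.inr_injective) I
  exact ⟨J, by rw [hJ, submatrix_symm_submatrix, det_submatrix_fromCols_one_inr, norm_one]⟩

/-- For `A = [Y | 1] ∘ ε⁻¹`: every entry `Y i j` is a compound coordinate in norm (identity columns with column `i` replaced by column `j`
of `Y`). [cite: GelbartPiatetskishapiroRallis1987, Part A §1] -/
theorem exists_compound_fromCols_one_norm_eq_entry {R : Type*} [NormedCommRing R] {m κ : Type*} [LinearOrder m] [LinearOrder κ]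
    [Fintype m] {k : ℕ} (hm : Fintype.card m = k) (ε : m ⊕ m ≃ κ) (Y : Matrix m m R) (I : Set.powersetCard m k) (i j : m) :
    ∃ J : Set.powersetCard κ k, ‖compound k ((Matrix.fromCols Y (1 : Matrix m m R)).submatrix id ε.symm) I J‖ = ‖Y i j‖ := by
  have hinj : Function.Injective (fun l : m => if l = i then (Sum.inl j : m ⊕ m) else Sum.inr l) := by
    intro a b hab
    by_cases ha : a = i <;> by_cases hb : b = i
    · rw [ha, hb]
    · simp [ha, hb] at hab
    · simp [ha, hb] at hab
    · simpa [ha, hb] using hab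
  obtain ⟨J, hJ⟩ := exists_compound_norm_eq hm ((Matrix.fromCols Y (1 : Matrix m m R)).submatrix id ε.symm)
    (ε.injective.comp hinj) I
  refine ⟨J, ?_⟩
  rw [hJ]
  change ‖(((Matrix.fromCols Y (1 : Matrix m m R)).submatrix id ε.symm).submatrix id
    (ε ∘ fun l : m => if l = i then (Sum.inl j : m ⊕ m) else Sum.inr l)).det‖ = _
  rw [submatrix_symm_submatrix, det_submatrix_fromCols_one_colSel]

/-- `[Y | −1] = −[−Y | 1]`. [folklore] -/
theorem fromCols_neg_one_eq {R : Type*} [CommRing R] {m : Type*} [DecidableEq m] (Y : Matrix m m R) :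
    Matrix.fromCols Y (-1 : Matrix m m R) = -Matrix.fromCols (-Y) (1 : Matrix m m R) := by
  ext i (j | j) <;> simp [Matrix.fromCols_apply_inl, Matrix.fromCols_apply_inr]

/-- The compound of `−A` in degree `k` is `(−1)^k` times that of `A` (each `k × k` minor). [folklore] -/
theorem compound_neg_apply {R : Type*} [CommRing R] {m κ : Type*} [LinearOrder m] [LinearOrder κ] {k : ℕ}
    (A : Matrix m κ R) (I : Set.powersetCard m k) (J : Set.powersetCard κ k) :
    compound k (-A) I J = (-1) ^ k * compound k A I J := by
  rw [compound_apply, compound_apply]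
  have : (-A).submatrix (ofFinEmbEquiv.symm I) (ofFinEmbEquiv.symm J) = -A.submatrix (ofFinEmbEquiv.symm I) (ofFinEmbEquiv.symm J) := by
    ext a b
    simp
  rw [this, Matrix.det_neg, Fintype.card_fin]

/-- `‖(−1)^k · c‖ = ‖c‖`. [folklore] -/
theorem norm_neg_one_pow_mul {R : Type*} [NormedCommRing R] (k : ℕ) (c : R) : ‖(-1 : R) ^ k * c‖ = ‖c‖ := by
  rcases neg_one_pow_eq_or R k with h | h
  · rw [h, one_mul]
  · rw [h, neg_one_mul, norm_neg]

/-- `(−X) ∘ ε⁻¹ = −(X ∘ ε⁻¹)`. [folklore] -/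
theorem neg_submatrix {R : Type*} [CommRing R] {m l κ : Type*} (X : Matrix m l R) (ε : l ≃ κ) :
    (-X).submatrix id ε.symm = -(X.submatrix id ε.symm) := by
  ext a b
  simp

/-- For the DOUBLING element `A = [G | −1] ∘ ε⁻¹` (`R₀ · ι(g,1)` in the frame of the height of record, `ε = e₂`): some compound coordinate has
norm `1`. [cite: GelbartPiatetskishapiroRallis1987, Part A §1] -/
theorem exists_compound_fromCols_neg_one_norm_eq_one {R : Type*} [NormedCommRing R] [NormOneClass R] {m κ : Type*} [LinearOrder m]
    [LinearOrder κ] [Fintype m] {k : ℕ} (hm : Fintype.card m = k) (ε : m ⊕ m ≃ κ) (G : Matrix m m R) (I : Set.powersetCard m k) :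
    ∃ J : Set.powersetCard κ k, ‖compound k ((Matrix.fromCols G (-1 : Matrix m m R)).submatrix id ε.symm) I J‖ = 1 := by
  obtain ⟨J, hJ⟩ := exists_compound_fromCols_one_norm_eq_one hm ε (-G) I
  refine ⟨J, ?_⟩
  rw [fromCols_neg_one_eq, neg_submatrix, compound_neg_apply, norm_neg_one_pow_mul, hJ]

/-- For the DOUBLING element `A = [G | −1] ∘ ε⁻¹`: every entry `G i j` is a compound coordinate in norm.
[cite: GelbartPiatetskishapiroRallis1987, Part A §1] -/
theorem exists_compound_fromCols_neg_one_norm_eq_entry {R : Type*} [NormedCommRing R] {m κ : Type*} [LinearOrder m] [LinearOrder κ]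
    [Fintype m] {k : ℕ} (hm : Fintype.card m = k) (ε : m ⊕ m ≃ κ) (G : Matrix m m R) (I : Set.powersetCard m k) (i j : m) :
    ∃ J : Set.powersetCard κ k, ‖compound k ((Matrix.fromCols G (-1 : Matrix m m R)).submatrix id ε.symm) I J‖ = ‖G i j‖ := by
  obtain ⟨J, hJ⟩ := exists_compound_fromCols_one_norm_eq_entry hm ε (-G) I i j
  refine ⟨J, ?_⟩
  rw [fromCols_neg_one_eq, neg_submatrix, compound_neg_apply, norm_neg_one_pow_mul, hJ, Matrix.neg_apply, norm_neg]

end Summit.HodgeConjecture.HodgeConjecture.Cruxes.HLiu418.K2LiuDoublingPluckerCoordinates
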